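import Summits.CriticalPhenomena.PercolationContinuityZ3.Theses.PercNearOneGluingNoHeavy

/-!
# `Assembly` (route PercNearOneGluingNoHeavy, item stmt-CriticalPhenomena-20246)

The assembly item of the sibling route `PercNearOneGluingNoHeavy` (sub-problem
`PercolationContinuityZ3`): `NearOneGluing → PercolationContinuityZ3`.

It is the sibling route `PercNearOneGluing`'s landed assembly
(`percNearOneGluing_assembly_proof : KNSlabBridge → NearOneGluing → PercolationContinuityZ3`,
item stmt-CriticalPhenomena-4580) with its bridge hypothesis discharged by the landed
`KNSlabBridge_proof` (item stmt-CriticalPhenomena-10357). The decl `NearOneGluing` of this route is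
by definition the same proposition as the sibling's, so the term applies verbatim (exactly as in the
route file's inline `closes`).
-/

namespace Summit.CriticalPhenomena.PercolationContinuityZ3.Theorems

/-- **Assembly of route PercNearOneGluingNoHeavy** (settles `stmt-CriticalPhenomena-20246`, exact
signature): `NearOneGluing → PercolationContinuityZ3` — Kozma–Nitzan near-one gluing (Conjecture 3
over finite weighted graphs) decides continuity of the percolation probability on `ℤ³`, via the
proved slab bridge `KNSlabBridge_proof` and the sibling route's proved assembly
`percNearOneGluing_assembly_proof` (Duminil-Copin–Sidoravicius–Tassion: no slab percolates at
`p_c(ℤ³)`). [folklore] -/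
theorem percNearOneGluingNoHeavy_assembly_proof :
    Summit.CriticalPhenomena.PercolationContinuityZ3.Theses.PercNearOneGluingNoHeavy.Assembly := by
  unfold Summit.CriticalPhenomena.PercolationContinuityZ3.Theses.PercNearOneGluingNoHeavy.Assembly
  intro hX
  exact percNearOneGluing_assembly_proof KNSlabBridge_proof hX

end Summit.CriticalPhenomena.PercolationContinuityZ3.Theorems
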